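import Summits.QuantumAdvantage.QuantumAdvantage.Theorems.WbwObfuscatedGluedTreesKowVocabulary

/-!
# `WbwObfuscatedGluedTrees` (stmt-QuantumAdvantage-2340) — line `knowledge-of-walk-split`, instantiation pass: LEVEL-AWARE VOCABULARY

Definitions file (no theorem content beyond unfolding lemmas) for the INSTANTIATION pass of the line
`knowledge-of-walk-split` (lead prover-line-stmt-QuantumAdvantage-2340-c1-0, continuation of
prover-line-stmt-QuantumAdvantage-2340-0) of the informal crux `WbwObfuscatedGluedTrees` of route
`Summits/QuantumAdvantage/QuantumAdvantage/Theses/WhiteBoxWalk`.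

Why a second vocabulary.  The landed generator
`Literature.Computability.Cryptography.ObfuscatedGluedTrees.gen Λ O P` (definition item, landed 2026-08-16)
obfuscates the circuit presentation `Λ.circ n K` whose ARITY `2·N(n)` and wiring depend on the seed LENGTH
`n = |s|` and not only on the key material `K = s.take (4·keyPartLen n)`; the generator shapes `genObf`,
`genClear`, `keyed` of `WbwObfuscatedGluedTreesKowVocabulary` index the circuit family by the key ALONE
(`C : (k : List Bool) → Circuit (Fin (m k))`), and no choice of key length makes `n` a function of the key
(an injective `h` with `h n ≤ n − (coins)` does not exist, by counting).  So the three shapes are re-issued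
with the level `n` passed to the arity, the circuit family, the entrance name and the answer:

* `genObfL O κ h m C nm s = ⟨code of O(κ n, C n k; coins), nm n k⟩`, `k = s.take (h n)`, coins = the prefix
  of the seed tail of length `O.coins (κ n) (C n k)` (exactly as `genObf`, one more argument);
* `genClearL h m C nm s = ⟨code of C n k, nm n k⟩`; `keyedL h ans s = ans n k`;
* `blockSwap a b c s`: the seed re-parametrisation exchanging the two blocks of lengths `b n` and `c n` that
  follow the first `a n` bits (a permutation of `{0,1}ⁿ` for every `n`; used to move the obfuscator's coin
  segment of `gen Λ O P` behind the reference obfuscator's coin segment).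

The level-aware transfer lemmas (`stub_levelObfuscationMonotone`, `stub_levelBestPossibleStep`) and the
instantiation theorem live in their own files and import this one.  No hardness is asserted here.
-/

set_option linter.dupNamespace false

namespace Summit.QuantumAdvantage.QuantumAdvantage.Theorems.WbwObfuscatedGluedTrees.KnowledgeOfWalk

open Literature.Computability.Cryptography Literature.Computability.Complexity

/-! ## Level-aware generator shapes -/

/-- The OBFUSCATED generator built from a LEVEL-AWARE key-indexed circuit family `C n k` (arity `m n k`):
at a seed `s` of length `n`, the key is `k := s.take (h n)`, the obfuscator's coins are the prefix of length
`O.coins (κ n) (C n k)` of the tail `s.drop (h n)`, and the instance is `⟨code of O(κ n, C n k; coins), nm n k⟩`.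
(`genObf` with the level passed to `m`, `C`, `nm`.) [folklore] -/
def genObfL (O : CircuitObfuscator) (κ h : ℕ → ℕ) (m : ℕ → List Bool → ℕ)
    (C : (n : ℕ) → (k : List Bool) → Circuit (Fin (m n k))) (nm : ℕ → List Bool → List Bool)
    (s : List Bool) : List Bool :=
  boolPair
    (encodeSizedCircuit ⟨m s.length (s.take (h s.length)),
      O.obf (κ s.length) (C s.length (s.take (h s.length)))
        ((s.drop (h s.length)).take (O.coins (κ s.length) (C s.length (s.take (h s.length)))))⟩)
    (nm s.length (s.take (h s.length)))

/-- The CLEAR generator for a level-aware family: `⟨code of C n k, nm n k⟩`, `k = s.take (h n)` (the seed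
tail is unused). [folklore] -/
def genClearL (h : ℕ → ℕ) (m : ℕ → List Bool → ℕ) (C : (n : ℕ) → (k : List Bool) → Circuit (Fin (m n k)))
    (nm : ℕ → List Bool → List Bool) (s : List Bool) : List Bool :=
  boolPair (encodeSizedCircuit ⟨m s.length (s.take (h s.length)), C s.length (s.take (h s.length))⟩)
    (nm s.length (s.take (h s.length)))

/-- A level-aware key-indexed string (answer / name) read off the seed: `ans n (s.take (h n))`. [folklore] -/
def keyedL (h : ℕ → ℕ) (ans : ℕ → List Bool → List Bool) (s : List Bool) : List Bool :=
  ans s.length (s.take (h s.length))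

/-- At a seed of length `n`, `genObfL` is the obfuscated instance of the key `s.take (h n)` with the coin
prefix of the seed tail. [folklore] -/
theorem genObfL_eq (O : CircuitObfuscator) (κ h : ℕ → ℕ) (m : ℕ → List Bool → ℕ)
    (C : (n : ℕ) → (k : List Bool) → Circuit (Fin (m n k))) (nm : ℕ → List Bool → List Bool)
    {n : ℕ} {s : List Bool} (hs : s.length = n) :
    genObfL O κ h m C nm s =
      boolPair (encodeSizedCircuit ⟨m n (s.take (h n)), O.obf (κ n) (C n (s.take (h n)))
        ((s.drop (h n)).take (O.coins (κ n) (C n (s.take (h n)))))⟩) (nm n (s.take (h n))) := by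
  subst hs; rfl

/-- At a seed of length `n`, `genClearL` is the clear instance of the key `s.take (h n)`. [folklore] -/
theorem genClearL_eq (h : ℕ → ℕ) (m : ℕ → List Bool → ℕ)
    (C : (n : ℕ) → (k : List Bool) → Circuit (Fin (m n k))) (nm : ℕ → List Bool → List Bool)
    {n : ℕ} {s : List Bool} (hs : s.length = n) :
    genClearL h m C nm s =
      boolPair (encodeSizedCircuit ⟨m n (s.take (h n)), C n (s.take (h n))⟩) (nm n (s.take (h n))) := by
  subst hs; rfl

/-- At a seed of length `n`, `keyedL h ans s = ans n (s.take (h n))`. [folklore] -/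
theorem keyedL_eq (h : ℕ → ℕ) (ans : ℕ → List Bool → List Bool) {n : ℕ} {s : List Bool}
    (hs : s.length = n) : keyedL h ans s = ans n (s.take (h n)) := by
  subst hs; rfl

/-- The level-oblivious shapes are the special case of level-aware ones (constant in the level).
[folklore] -/
theorem genObf_eq_genObfL (O : CircuitObfuscator) (κ h : ℕ → ℕ) (m : List Bool → ℕ)
    (C : (k : List Bool) → Circuit (Fin (m k))) (nm : List Bool → List Bool) :
    genObf O κ h m C nm = genObfL O κ h (fun _ => m) (fun _ => C) (fun _ => nm) := rfl

/-- `genClear` is the level-constant case of `genClearL`. [folklore] -/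
theorem genClear_eq_genClearL (h : ℕ → ℕ) (m : List Bool → ℕ)
    (C : (k : List Bool) → Circuit (Fin (m k))) (nm : List Bool → List Bool) :
    genClear h m C nm = genClearL h (fun _ => m) (fun _ => C) (fun _ => nm) := rfl

/-- `keyed` is the level-constant case of `keyedL`. [folklore] -/
theorem keyed_eq_keyedL (h : ℕ → ℕ) (ans : List Bool → List Bool) :
    keyed h ans = keyedL h (fun _ => ans) := rfl

/-! ## Seed re-parametrisation: swapping two blocks -/

/-- `blockSwap a b c s`: cut `s` (of length `n`) as `A ++ X ++ Y ++ Z` with `|A| = a n`, `|X| = b n`,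
`|Y| = c n` (blocks truncated at the end of `s` when `s` is short) and return `A ++ Y ++ X ++ Z`.  For every
`n` this is a permutation of `{0,1}ⁿ` (a re-indexing of positions); on seeds with `a n + b n + c n ≤ n` its
inverse is `blockSwap a c b`. [folklore] -/
def blockSwap (a b c : ℕ → ℕ) (s : List Bool) : List Bool :=
  s.take (a s.length) ++
    (((s.drop (a s.length + b s.length)).take (c s.length)) ++
      (((s.drop (a s.length)).take (b s.length)) ++ s.drop (a s.length + b s.length + c s.length)))

/-- `blockSwap` preserves the length. [folklore] -/
@[simp] theorem length_blockSwap (a b c : ℕ → ℕ) (s : List Bool) :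
    (blockSwap a b c s).length = s.length := by
  simp only [blockSwap, List.length_append, List.length_take, List.length_drop]
  omega

/-- Registered helper stub of crux stmt-QuantumAdvantage-2340 (`ledger workitem stub-add`; the gate admits a
`--supports` file only if it proves a registered stub): the level-oblivious obfuscated generator is the
level-constant case of the level-aware one. [folklore] -/
theorem toolkit_levelVocabulary :
    ∀ (O : CircuitObfuscator) (κ h : ℕ → ℕ) (m : List Bool → ℕ)
      (C : (k : List Bool) → Circuit (Fin (m k))) (nm : List Bool → List Bool),
      genObf O κ h m C nm = genObfL O κ h (fun _ => m) (fun _ => C) (fun _ => nm) :=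
  fun _ _ _ _ _ _ => rfl

end Summit.QuantumAdvantage.QuantumAdvantage.Theorems.WbwObfuscatedGluedTrees.KnowledgeOfWalk
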